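import Summits.BirchSwinnertonDyer.BirchSwinnertonDyer.Theorems.ByReductionTypeAtTwoMultTowerClass220374y
import Summits.BirchSwinnertonDyer.BirchSwinnertonDyer.Theorems.ByReductionTypeAtTwoMultUpperHalfTowerFiltKernel
import HarnessLib

/-!
# Positive control for the binder-free σ-lever doors (`MultTowerFiltKernel`, p544104): the FILED filtration certificate of the class
# **220374y** (tranche B1, `…MultTowerClass220374y`, window `(n, m, w) = (3, 1, 7)`, NON-SPLIT two bits) re-proved with the SAME counts
# and margin and NO local binder (seat bsd-2adic-mult-2 GEN 9)

HONEST FRAMING (cell `bsd-2adic`, run/shared/lean/pub/bsd-2adic/, HUMAN RULINGS D-0036 / D-0054 / D-0074): research route; ONE THEOREM, a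
demonstration that the kernel-mode door consumes exactly the filed certificate (`hlow`, `hup`, `had`) and the curve data of the landed class
file (imported, not re-declared) — `h33g`/`hM`/`hA`/`hNS2` are gone (discharged inside `MultTowerFiltKernel.…` by tower-1's `_holds` theorems and
`MultTowerCert.atTwo_le_four_of_nonsplit_kernel`). Nothing is booked; BSD is not proved by any of this. PARTITION: X5@2 mult (K4ᵐ, B1·O1) × p = 2
— types-the-object-of; closes none. bears_on: K4 (item 19922). Template for successor generator lanes (`filtgen.py`, `KERNEL_FILT = True`).
References: R. Greenberg, LNM 1716 (1999) §§1, 3; L. Washington, *Introduction to Cyclotomic Fields*, §13.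
-/

set_option autoImplicit false
-- the Theorems namespace of this sub repeats the summit name by design (D-0017 nested layout: Summit.<S>.<Sub>)
set_option linter.dupNamespace false

noncomputable section

open scoped Classical MatrixGroups ModularForm

open NumberField IsDedekindDomain CongruenceSubgroup WeierstrassCurve Literature.NumberTheory.EllipticCurves
  Literature.NumberTheory.EllipticCurves.ModularForms Literature.NumberTheory.EllipticCurves.Rank1Residual
  Literature.NumberTheory.EllipticCurves.Rank1Residual.Typed
  Literature.NumberTheory.EllipticCurves.Greenberg1999
  Summit.BirchSwinnertonDyer.Rank1Residual.X5 Summit.BirchSwinnertonDyer.Rank1Residual.X5.O1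
  Summit.BirchSwinnertonDyer.Rank1Residual.X5.Instances
  Summit.BirchSwinnertonDyer.BirchSwinnertonDyer.Theorems.KatoHalfPinch
  Summit.BirchSwinnertonDyer.BirchSwinnertonDyer.Theorems.MultTowerClass

namespace Summit.BirchSwinnertonDyer.BirchSwinnertonDyer.Theorems.MultTowerFiltKernelDemo

/-- **Tower gap for `220374y1` from ONE layer `ℚ_3` and the window `(m, w) = (1, 7)` of the `(σ−1)`-filtration of
`Sel_{2^∞}(E/ℚ_3)[2]`** (the σ-lever, `MultTowerFiltKernel`): every local binder discharged by name (tower-1 `…_holds` + kernel theorems at `2`) + the two FILTERED counts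
`2^a ≤ #{z ∈ Sel_3[2] : (conj_γ−id)^[1] z = 0}`, `#{z ∈ Sel_3[2] : (conj_γ−id)^[8] z = 0} ≤ 2^d` with `d + 2 + 2 + 1 ≤ 7 + a`
(local bits `Σ_3 = 2` at the odd primes; `C₂ = 4` at the NON-SPLIT multiplicative `2` (KERNEL: `MultTowerCert.atTwo_le_four_of_nonsplit_kernel`, Greenberg p. 93)). [cite: GreenbergLNM1716, §1 p. 60 and §3 Lemmas 3.3–3.5 (PDF pp. 86–90), pp. 90–93]
[cite: Washington1997, §13.2] -/
theorem towerGapAtTwo_220374y1_f3w1x7_kernel {a d : ℕ}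
    (hlow : ∀ (κ : ZpExtension ℚ 2) (γ : Field.absoluteGaloisGroup ℚ), κ.IsCyclotomic → κ.IsTopGenerator γ →
      2 ^ a ≤ Nat.card {z : c220374y1.selmerLayer κ 3 // 2 • z = 0 ∧
        (⇑(c220374y1.conjH1 2 (κ.layerSubgroup 3) γ - AddMonoidHom.id (c220374y1.subgroupH1 2 (κ.layerSubgroup 3))))^[1] (z : c220374y1.subgroupH1 2 (κ.layerSubgroup 3)) = 0})
    (hup : ∀ (κ : ZpExtension ℚ 2) (γ : Field.absoluteGaloisGroup ℚ), κ.IsCyclotomic → κ.IsTopGenerator γ →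
      Nat.card {z : c220374y1.selmerLayer κ 3 // 2 • z = 0 ∧
        (⇑(c220374y1.conjH1 2 (κ.layerSubgroup 3) γ - AddMonoidHom.id (c220374y1.subgroupH1 2 (κ.layerSubgroup 3))))^[1 + 7] (z : c220374y1.subgroupH1 2 (κ.layerSubgroup 3)) = 0} ≤ 2 ^ d)
    (had : d + 2 + 2 + 1 ≤ 7 + a) : TowerGapAtTwo c220374y1 := by
  refine MultTowerFiltKernel.towerGapAtTwo_of_filtration_cert_nonsplitTwo c220374y1 mult_two_220374y1 nonsplit_two_220374y1
    not_two_dvd_torsionOrder_220374y1 (n := 3) (m := 1) (w := 7) (by norm_num) {3, 7, 11, 53} ?_ mem_P_of_dvd_220374y1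
    (fun ℓ ↦ if ℓ = 3 then 2 else if ℓ = 11 then 2 else 1) (fun ℓ ↦ if ℓ = 7 then 1 else 0) (fun ℓ ↦ if ℓ = 3 then 9 else if ℓ = 7 then 7 else if ℓ = 53 then 3 else 1) ?_
    (fun ℓ _ hℓ ↦ ?_) hlow hup ?_
  · -- `P` consists of odd primes
    intro ℓ hℓ
    simp only [Finset.mem_insert, Finset.mem_singleton] at hℓ
    rcases hℓ with rfl | rfl | rfl | rfl <;> exact ⟨by norm_num, by norm_num⟩
  · -- `e_ℓ`: `¬ 2^(e_ℓ+4) ∣ ℓ² − 1`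
    intro ℓ hℓ
    simp only [Finset.mem_insert, Finset.mem_singleton] at hℓ
    rcases hℓ with rfl | rfl | rfl | rfl <;> norm_num
  · -- the local constants at the odd primes
    simp only [Finset.mem_insert, Finset.mem_singleton] at hℓ
    rcases hℓ with rfl | rfl | rfl | rfl
    · refine Or.inr (Or.inr (Or.inr (Or.inr (Or.inr ⟨?_, ?_, ?_, by norm_num, by norm_num, ?_, by norm_num⟩))))
      · rw [Instances.integralModelInt_baseChange_int, M220374y1_c₄]; norm_num
      · rw [minimalDiscriminantInt_220374y1]; norm_num
      · rw [minimalDiscriminantInt_220374y1]; norm_num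
      · rw [Instances.integralModelInt_baseChange_int, M220374y1_c₄]; norm_num
    · refine Or.inr (Or.inr (Or.inl ⟨hasMultiplicativeReductionAtPrime_220374y1 7 (Or.inl rfl), ?_, ?_, by norm_num, by norm_num⟩))
      · rw [minimalDiscriminantInt_220374y1]; norm_num
      · rw [minimalDiscriminantInt_220374y1]; norm_num
    · exact Or.inr (Or.inl ⟨hasMultiplicativeReductionAtPrime_220374y1 11 (Or.inr (Or.inl rfl)), by norm_num⟩)
    · refine Or.inr (Or.inr (Or.inl ⟨hasMultiplicativeReductionAtPrime_220374y1 53 (Or.inr (Or.inr (rfl))), ?_, ?_, by norm_num, by norm_num⟩))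
      · rw [minimalDiscriminantInt_220374y1]; norm_num
      · rw [minimalDiscriminantInt_220374y1]; norm_num
  · -- the arithmetic with variable counts: `2^d * 4 · 2^2 < 2^(7 + a)`
    have hP : ∏ ℓ ∈ ({3, 7, 11, 53} : Finset ℕ), (fun ℓ ↦ if ℓ = 3 then 2 else if ℓ = 11 then 2 else 1) ℓ ^ 2 ^ min 3 ((fun ℓ ↦ if ℓ = 7 then 1 else 0) ℓ) = 2 ^ 2 := by
      decide
    rw [hP, show (2 : ℕ) ^ d * 4 = 2 ^ (d + 2) by rw [pow_add]; norm_num, ← pow_add]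
    exact Nat.pow_lt_pow_right (by norm_num) (by omega)

end Summit.BirchSwinnertonDyer.BirchSwinnertonDyer.Theorems.MultTowerFiltKernelDemo

end
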